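import Summits.CriticalPhenomena.PercolationContinuityZ3.Theorems.PercNearOneGluingNoHeavyLowerTailSahiCTCLadderThreeRowFourPrep
import HarnessLib

/-!
# `NoHeavyLowerTail` (crux stmt-CriticalPhenomena-4575), P3 lane: the cubes and the charge of an arbitrary row of `(L_t)`

Support file (seat `prim-l12-p3`, gen 26; `--supports stmt-CriticalPhenomena-4575`).  Memo g26 §4.17 / README blueprint.  For a profile
`m` with exponents ≤ 2 (`D = dbl m`, `T = lev m 1`) and any level `t`:
* `coeff_harris_cube_general`: for `A ⊆ D`, `Y ⊆ T`, `[m − 1_{A ∪ Y}] H = κ(D ∖ A, A ∪ (T ∖ Y))` — every cube of every row;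
* `cubes_le_coeff_ee_mul_harris_general`: `Σ_{(A,Y) : A ⊆ D, Y ⊆ T, #A + #Y = t} κ(D∖A, A ∪ T∖Y) ≤ [m](e_t·H)`;
* `coeff_chargeT_le_kinds`: `[m](Θ_{t−1}·e_{≥t}·GF(W)) ≤ Σ_j cH(t − (#D − j), #T + 2j − t) · #{(A,Y) : #A = j, #Y = t−j, A ∪ Y ∈ W}`.
These are the row-independent halves of the facts files of the blueprint (the cube types are the fibres `#A = i`).  Nothing is asserted
about the crux.
-/

namespace Summit.CriticalPhenomena.PercolationContinuityZ3.Theorems.SahiCTCForms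

open Finset MvPolynomial SahiCTCGenFun SahiCTCWeightedLYM

variable {α : Type*} [DecidableEq α] [Fintype α]

section CubesGeneral
variable {𝒳 𝒵 : Finset (Finset α)}

/-- **The cube at `(A, Y)`**: `[m − 1_{A ∪ Y}] H = κ(D ∖ A, A ∪ (T ∖ Y))` for `A ⊆ D = dbl m`, `Y ⊆ T = lev m 1`. [this work] -/
theorem coeff_harris_cube_general {m : α →₀ ℕ} (hm : ∀ i, m i ≤ 2) {A Y : Finset α} (hA : A ⊆ dbl m) (hY : Y ⊆ lev m 1) :
    (PiP * gf (𝒳 ∩ 𝒵) - gf 𝒳 * gf 𝒵).coeff (m - ind (A ∪ Y)) = kap 𝒳 𝒵 (dbl m \ A) (A ∪ (lev m 1 \ Y)) := by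
  rw [coeff_harrisForm_eq_kap _ _ (sub_ind_le_two_of_le_two hm _), dbl_sub_ind_of_le_two hm, sgl_sub_ind_of_le_two hm]
  have hDT := disjoint_dbl_lev_one m
  have hYD : Disjoint (dbl m) Y := hDT.mono_right hY
  have hAT : Disjoint A (lev m 1) := hDT.mono_left hA
  congr 1
  · ext i; simp only [mem_sdiff, mem_union, not_or]
    constructor
    · rintro ⟨hi, hA', _⟩; exact ⟨hi, hA'⟩
    · rintro ⟨hi, hA'⟩; exact ⟨hi, hA', fun h => disjoint_left.1 hYD hi h⟩
  · ext i; simp only [mem_union, mem_inter, mem_sdiff, not_or]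
    constructor
    · rintro (⟨hi, hA' | hY'⟩ | ⟨hi, hA', hY'⟩)
      · exact Or.inl hA'
      · exact absurd hY' (fun h => disjoint_left.1 hYD hi h)
      · exact Or.inr ⟨hi, hY'⟩
    · rintro (hA' | ⟨hi, hY'⟩)
      · exact Or.inl ⟨hA hA', Or.inl hA'⟩
      · exact Or.inr ⟨hi, fun h => disjoint_left.1 hAT h hi, hY'⟩

/-- **All cubes of a row**: `Σ_{A ⊆ D, Y ⊆ T, #A + #Y = t} κ(D ∖ A, A ∪ (T ∖ Y)) ≤ [m](e_t·H)`. [this work] -/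
theorem cubes_le_coeff_ee_mul_harris_general (h𝒳 : IsUpperSet (𝒳 : Set (Finset α))) (h𝒵 : IsUpperSet (𝒵 : Set (Finset α)))
    (t : ℕ) {m : α →₀ ℕ} (hm : ∀ i, m i ≤ 2) :
    ∑ q ∈ ((dbl m).powerset ×ˢ (lev m 1).powerset).filter (fun q => #q.1 + #q.2 = t),
        kap 𝒳 𝒵 (dbl m \ q.1) (q.1 ∪ (lev m 1 \ q.2)) ≤ (ee t * (PiP * gf (𝒳 ∩ 𝒵) - gf 𝒳 * gf 𝒵)).coeff m := by
  set I := ((dbl m).powerset ×ˢ (lev m 1).powerset).filter (fun q => #q.1 + #q.2 = t)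
  have hDT := disjoint_dbl_lev_one m
  have hinj : Set.InjOn (fun q : Finset α × Finset α => q.1 ∪ q.2) ↑I := by
    intro q hq q' hq' h
    obtain ⟨hq1, _⟩ := mem_filter.1 (Finset.mem_coe.1 hq)
    obtain ⟨hq1', _⟩ := mem_filter.1 (Finset.mem_coe.1 hq')
    obtain ⟨hA, hY⟩ := mem_product.1 hq1
    obtain ⟨hA', hY'⟩ := mem_product.1 hq1'
    rw [mem_powerset] at hA hY hA' hY'
    have h' : q.1 ∪ q.2 = q'.1 ∪ q'.2 := h
    have e1 : q.1 = q'.1 := by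
      have e := congrArg (fun s => s ∩ dbl m) h'
      simp only [union_inter_distrib_right, inter_eq_left.2 hA, inter_eq_left.2 hA',
        disjoint_iff_inter_eq_empty.1 (hDT.symm.mono_left hY), disjoint_iff_inter_eq_empty.1 (hDT.symm.mono_left hY'),
        union_empty] at e
      exact e
    have e2 : q.2 = q'.2 := by
      have e := congrArg (fun s => s ∩ lev m 1) h'
      simp only [union_inter_distrib_right, inter_eq_left.2 hY, inter_eq_left.2 hY',
        disjoint_iff_inter_eq_empty.1 (hDT.mono_left hA), disjoint_iff_inter_eq_empty.1 (hDT.mono_left hA'), empty_union] at e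
      exact e
    exact Prod.ext e1 e2
  have hadm : I.image (fun q => q.1 ∪ q.2) ⊆ (bySize (· = t) : Finset (Finset α)).filter fun E => ind E ≤ m := by
    intro E hE
    obtain ⟨q, hq, rfl⟩ := mem_image.1 hE
    obtain ⟨hq1, hqt⟩ := mem_filter.1 hq
    obtain ⟨hA, hY⟩ := mem_product.1 hq1
    rw [mem_powerset] at hA hY
    rw [mem_filter, bySize, mem_filter, SahiAllButC.ind_le_iff_subset_support, support_eq_dbl_union_lev hm]
    refine ⟨⟨mem_powerset.2 (subset_univ _), ?_⟩, union_subset_union hA hY⟩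
    rw [card_union_of_disjoint (Disjoint.mono hA hY hDT), hqt]
  have hsur := sum_le_coeff_ee_mul_harris h𝒳 h𝒵 t m hadm
  rw [sum_image hinj] at hsur
  refine le_trans (le_of_eq ?_) hsur
  refine sum_congr rfl fun q hq => ?_
  obtain ⟨hq1, _⟩ := mem_filter.1 hq
  obtain ⟨hA, hY⟩ := mem_product.1 hq1
  rw [mem_powerset] at hA hY
  exact (coeff_harris_cube_general hm hA hY).symm

/-- **The charge of a row by kinds**: `[m](Θ_{t−1}·e_{≥t}·GF(W)) ≤ Σ_{j ≤ #D} cH(t − (#D − j), #T + 2j − t) · #{(A,Y) : A ⊆ D, #A = j,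
Y ⊆ T, #Y = t − j, A ∪ Y ∈ W}` for a family `W` of `t`-sets (`t ≥ 1`). [this work] -/
theorem coeff_chargeT_le_kinds {t : ℕ} (ht : 1 ≤ t) {m : α →₀ ℕ} (hm : ∀ i, m i ≤ 2) (W : Finset (Finset α)) (hW : ∀ w ∈ W, #w = t) :
    (gf (bySize (· ≤ t - 1) : Finset (Finset α)) * gf (bySize (t ≤ ·) : Finset (Finset α)) * gf W).coeff m ≤
      ∑ j ∈ range (#(dbl m) + 1), (cH (t - (#(dbl m) - j)) (#(lev m 1) + 2 * j - t) : ℤ) *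
        #((((dbl m).powersetCard j) ×ˢ ((lev m 1).powersetCard (t - j))).filter fun q => q.1 ∪ q.2 ∈ W) := by
  rw [coeff_chargeT_eq_sum]
  set Wm := W.filter fun w => ind w ≤ m with hWm
  have hDT := disjoint_dbl_lev_one m
  have hsupp : ∀ w ∈ Wm, w ⊆ dbl m ∪ lev m 1 := fun w hw => by
    rw [← support_eq_dbl_union_lev hm]; exact (SahiAllButC.ind_le_iff_subset_support _ _).1 (mem_filter.1 hw).2
  have hsplit : ∀ w ∈ Wm, #(dbl m ∩ w) + #(lev m 1 ∩ w) = t := fun w hw => by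
    rw [← card_union_of_disjoint (Disjoint.mono inter_subset_left inter_subset_left hDT), ← union_inter_distrib_right,
      inter_eq_right.2 (hsupp w hw), hW w (mem_filter.1 hw).1]
  have hval : ∀ w ∈ Wm, (gf (bySize (· ≤ t - 1) : Finset (Finset α)) * gf (bySize (t ≤ ·) : Finset (Finset α))).coeff (m - ind w)
      = (cH (t - (#(dbl m) - #(dbl m ∩ w))) (#(lev m 1) + 2 * #(dbl m ∩ w) - t) : ℤ) := fun w hw => by
    rw [coeff_thetaT_mul_atLeastT_eq_cH ht (sub_ind_le_two_of_le_two hm w), dbl_sub_ind_of_le_two hm, sgl_sub_ind_of_le_two hm]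
    have h1 : #(dbl m \ w) = #(dbl m) - #(dbl m ∩ w) := by
      have := card_sdiff_add_card_inter (dbl m) w; omega
    have h2 : #(dbl m ∩ w ∪ lev m 1 \ w) = #(dbl m ∩ w) + #(lev m 1 \ w) :=
      card_union_of_disjoint (Disjoint.mono inter_subset_left sdiff_subset hDT)
    have h3 : #(lev m 1 \ w) + #(lev m 1 ∩ w) = #(lev m 1) := card_sdiff_add_card_inter _ _
    have h4 := hsplit w hw
    rw [h1, h2]; congr 2; omega
  rw [sum_congr rfl hval]
  have hmaps : ∀ w ∈ Wm, #(dbl m ∩ w) ∈ range (#(dbl m) + 1) := fun w _ =>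
    mem_range.2 (Nat.lt_succ_of_le (card_le_card inter_subset_left))
  rw [← sum_fiberwise_of_maps_to' hmaps (fun j => (cH (t - (#(dbl m) - j)) (#(lev m 1) + 2 * j - t) : ℤ))]
  refine sum_le_sum fun j _ => ?_
  rw [sum_const, nsmul_eq_mul, mul_comm]
  refine mul_le_mul_of_nonneg_left ?_ (Nat.cast_nonneg _)
  have hc : #(Wm.filter fun w => #(dbl m ∩ w) = j) ≤
      #((((dbl m).powersetCard j) ×ˢ ((lev m 1).powersetCard (t - j))).filter fun q => q.1 ∪ q.2 ∈ W) := by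
    refine card_le_card_of_injOn (fun w => (dbl m ∩ w, lev m 1 ∩ w)) (fun w hw => ?_) (fun w hw w' hw' h => ?_)
    · obtain ⟨hw', hj⟩ := mem_filter.1 (Finset.mem_coe.1 hw)
      have h4 := hsplit w hw'
      have hsp : dbl m ∩ w ∪ lev m 1 ∩ w = w := by rw [← union_inter_distrib_right, inter_eq_right.2 (hsupp w hw')]
      have hj' : #(lev m 1 ∩ w) = t - j := by rw [← hj]; omega
      refine Finset.mem_coe.2 (mem_filter.2 ⟨mem_product.2 ⟨mem_powersetCard.2 ⟨inter_subset_left, hj⟩,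
        mem_powersetCard.2 ⟨inter_subset_left, hj'⟩⟩, ?_⟩)
      show dbl m ∩ w ∪ lev m 1 ∩ w ∈ W
      rw [hsp]; exact (mem_filter.1 hw').1
    · have hs := hsupp w (mem_filter.1 (Finset.mem_coe.1 hw)).1
      have hs' := hsupp w' (mem_filter.1 (Finset.mem_coe.1 hw')).1
      have h1 : dbl m ∩ w = dbl m ∩ w' := congrArg Prod.fst h
      have h2 : lev m 1 ∩ w = lev m 1 ∩ w' := congrArg Prod.snd h
      rw [← inter_eq_right.2 hs, ← inter_eq_right.2 hs', union_inter_distrib_right, union_inter_distrib_right, h1, h2]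
  exact_mod_cast hc

end CubesGeneral

end Summit.CriticalPhenomena.PercolationContinuityZ3.Theorems.SahiCTCForms
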